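import Literature.AlgebraicGeometry.ShimuraVarieties.UnitaryShimuraCurveRecord
import HarnessLib

/-!
# The diagonal reciprocity twist `r_x(s) ∈ T(𝔸_f) ⊂ U(H)(𝔸_{L⁺,f})` exists — at every rank

Topic `AlgebraicGeometry/ShimuraVarieties`, namespace `…ShimuraVarieties.UnitaryCanonicalModel`. THEOREMS ONLY
(no definition, no named fact, no instance, no `sorry`).

For a CM field `L` (involution `c`), a `c`-hermitian Gram matrix `H ∈ M_n(L)`, an anisotropic vector `v ∈ Lⁿ`
(`⟪v, v⟫_H ≠ 0`) and a finite idèle `t ∈ 𝔸_{L,f}` with `t · c(t) = 1`, there is an element `d` of the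
finite-adelic unitary group `U(H)(𝔸_{L⁺,f})` (the tree's `UnitaryGroup.finAdelic … n H`) which multiplies
`v ⊗ 1` by `t` and fixes the `H`-orthogonal complement of `v` pointwise
(`exists_finAdelic_mulVec_eq_smul_and_perp`): `d = 1 + u · (v ⊗ 1) ⊗ ⟪v, ·⟫_H`, `u = (t − 1)/⟪v, v⟫`.
This is the representative `z_r(τ)` of [Deligne1979ShimuraVarieties] 2.2.4 / the value `r_x(s) ∈ T(𝔸_f)` of
[Milne2005ShimuraVarieties] (60)–(61) p. 114 for the torus `T = U(L·v) × U(v^⊥)` and the cocharacter `μ_x`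
which is `[τ̄] − [τ]` on `U(L·v)` and trivial on `U(v^⊥)`.

The rank-3 case is ★ `UnitaryCanonicalModel.exists_isDiagTwist` / `exists_isDiagTwist_recipFactor`
(`UnitaryShimuraCanonicalModel.lean`, hard-wired `Fin 3`, `adelicVec`, private `twistMat`); this file redoes that
matrix algebra at rank `n` WITHOUT auxiliary definitions (the rank-one perturbation `1 + (u • v⊗1) ⊗ r` is
written out, its covector `r = ⟪v, ·⟫_H ⊗ 1` characterised by hypotheses the final theorem discharges by `rfl`),
over the rank-generic carriers `adelicVecFin` (★ `UnitaryShimuraCurveRecord`) and `finAdelic … n H` (★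
`UnitaryGroupRestrictedProduct`), and specialises to the CURVE datum: the hypothesis
`IsDiagTwistGS L J⋆ w (recipFactor L s) d` of the reciprocity field `recip` of ★ `RecordGS` / `RecordSystemGS` is
satisfiable (`exists_isDiagTwistGS_recipFactor`) — the non-vacuity input of the descent of Hecke translates on the
unitary Shimura curve ([Milne2005ShimuraVarieties] Thm. 13.6).

## References
* [Milne2005ShimuraVarieties] J. S. Milne, *Introduction to Shimura varieties* (2005; held rev. 2017
  `paper:url-b0e8e4ca1c12`), Def. 12.5 p. 113, (60)–(62) p. 114.
* [Deligne1979ShimuraVarieties] P. Deligne, *Variétés de Shimura* (1979), 2.2.4.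
* [BergeronMillsonMoeglin2016Balls] N. Bergeron, J. Millson, C. Mœglin, ball-quotient companion, Part 2 §1.1
  (hermitian conventions).
-/

set_option autoImplicit false

noncomputable section

open Function NumberField IsDedekindDomain Matrix
open scoped Matrix
open Literature.NumberTheory.Automorphic Literature.NumberTheory.Automorphic.UnitaryGroup

namespace Literature.AlgebraicGeometry.ShimuraVarieties.UnitaryCanonicalModel

variable (L : Type) [Field L] [NumberField L] [IsCMField L]

/-! ### §1. Hermitian symmetry at any rank -/

/-- **Hermitian symmetry** of the sesquilinear form of a `c`-hermitian matrix, any finite index type: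
`⟪v, w⟫ = c(⟪w, v⟫)` for `c(H_{ij}) = H_{ji}` (rank-generic twin of ★ `hermForm_comm`, which is `Fin 3`).
[cite: BergeronMillsonMoeglin2016Balls, Part 2 §1.1] -/
theorem hermForm_conj_symm {m : Type*} [Fintype m] (H : Matrix m m L)
    (hH : ∀ i j, cmConjRingHom L (H i j) = H j i) (v w : m → L) :
    hermForm (cmConjRingHom L) H v w = cmConjRingHom L (hermForm (cmConjRingHom L) H w v) := by
  have hcc : ∀ x : L, cmConjRingHom L (cmConjRingHom L x) = x := fun x => by
    rw [cmConjRingHom_apply, cmConjRingHom_apply]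
    exact IsCMField.complexConj_apply_apply L x
  simp only [hermForm, dotProduct, mulVec, Function.comp_apply, map_sum, map_mul, hcc, hH,
    Finset.mul_sum]
  rw [Finset.sum_comm]
  refine Finset.sum_congr rfl fun i _ => Finset.sum_congr rfl fun j _ => ?_
  ring

/-- `⟪v, v⟫_H` is fixed by `c` (it lies in `L⁺`), any finite index type (rank-generic twin of ★
`conj_hermForm_self`). [cite: BergeronMillsonMoeglin2016Balls, Part 2 §1.1] -/
theorem conj_hermForm_self_eq {m : Type*} [Fintype m] (H : Matrix m m L)
    (hH : ∀ i j, cmConjRingHom L (H i j) = H j i) (v : m → L) :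
    cmConjRingHom L (hermForm (cmConjRingHom L) H v v) = hermForm (cmConjRingHom L) H v v :=
  (hermForm_conj_symm L H hH v v).symm

/-- The two spellings of hermitian-ness: `ᵗ(H^c) = H` gives `c(Hᵢⱼ) = Hⱼᵢ` (the hypothesis form of ★
`HermitianNegConeOrbitDensity` to that of ★ `Record.recip`'s twist lemmas), any index type.
[cite: BergeronMillsonMoeglin2016Balls, Part 2 §1.1] -/
theorem conj_apply_eq_of_transpose_map_eq {m : Type*} (H : Matrix m m L)
    (hH : (H.map (IsCMField.complexConj L))ᵀ = H) (i j : m) : cmConjRingHom L (H i j) = H j i := by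
  have h := congrFun (congrFun hH j) i
  rw [transpose_apply, Matrix.map_apply] at h
  rw [cmConjRingHom_apply]
  exact h

/-! ### §2. The rank-one twist `1 + (u • v⊗1) ⊗ ⟪v, ·⟫` over the finite adèles, rank `n` -/

section Twist

variable {n : ℕ} (H : Matrix (Fin n) (Fin n) L) (v : Fin n → L)

/-- `⟪v, ·⟫_H ⊗ 1` pairs with `w ⊗ 1` to `⟪v, w⟫ ⊗ 1`. [folklore] -/
private theorem covec_dotProduct_adelicVecFin (w : Fin n → L) :
    (fun j => algebraMap L (FiniteAdeleRing (𝓞 L) L) (((cmConjRingHom L ∘ v) ᵥ* H) j)) ⬝ᵥ adelicVecFin L w =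
      algebraMap L (FiniteAdeleRing (𝓞 L) L) (hermForm (cmConjRingHom L) H v w) := by
  have h1 : hermForm (cmConjRingHom L) H v w = ((cmConjRingHom L ∘ v) ᵥ* H) ⬝ᵥ w := by
    rw [hermForm, dotProduct_mulVec]
  rw [h1]
  simp only [adelicVecFin, dotProduct, ← map_mul, ← map_sum]

/-- `a(h₀⁻¹) · a(h₀) = 1` for `h₀ = ⟪v, v⟫ ≠ 0`. [folklore] -/
private theorem alg_inv_mul_fin (hv : hermForm (cmConjRingHom L) H v v ≠ 0) :
    algebraMap L (FiniteAdeleRing (𝓞 L) L) (hermForm (cmConjRingHom L) H v v)⁻¹ *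
      algebraMap L (FiniteAdeleRing (𝓞 L) L) (hermForm (cmConjRingHom L) H v v) = 1 := by
  rw [← map_mul, inv_mul_cancel₀ hv, map_one]

/-- `a(x)` is carried to `a(c x)` by `c ⊗ 1`. [folklore] -/
private theorem conjFiniteAdele_algebraMap_fin (x : L) :
    conjFiniteAdele (↥(maximalRealSubfield L)) L (IsCMField.complexConj L)
        (algebraMap L (FiniteAdeleRing (𝓞 L) L) x) =
      algebraMap L (FiniteAdeleRing (𝓞 L) L) (cmConjRingHom L x) := by
  rw [conjFiniteAdele_apply, FiniteAdeleRing.smul_algebraMap, cmConjRingHom_apply, AlgEquiv.smul_def]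

variable (r : Fin n → FiniteAdeleRing (𝓞 L) L)
  (hr : ∀ w : Fin n → L,
    r ⬝ᵥ adelicVecFin L w = algebraMap L (FiniteAdeleRing (𝓞 L) L) (hermForm (cmConjRingHom L) H v w))

include hr in
/-- `d · (v ⊗ 1) = t · (v ⊗ 1)` for `d = 1 + ((t-1)/h₀ • v⊗1) ⊗ r`, `r` the covector `⟪v, ·⟫ ⊗ 1`. [folklore] -/
private theorem twist_mulVec_self (hv : hermForm (cmConjRingHom L) H v v ≠ 0) (t : FiniteAdeleRing (𝓞 L) L) :
    (1 + vecMulVec (((t - 1) * algebraMap L (FiniteAdeleRing (𝓞 L) L) (hermForm (cmConjRingHom L) H v v)⁻¹) •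
        adelicVecFin L v) r) *ᵥ adelicVecFin L v = t • adelicVecFin L v := by
  rw [add_mulVec, one_mulVec, vecMulVec_mulVec, hr]
  have hinv := alg_inv_mul_fin L H v hv
  funext i
  simp only [Pi.add_apply, Pi.smul_apply, MulOpposite.smul_eq_mul_unop, MulOpposite.unop_op, smul_eq_mul]
  linear_combination ((t - 1) * adelicVecFin L v i) * hinv

include hr in
/-- `d · (w ⊗ 1) = w ⊗ 1` for `w ⊥_H v`, any coefficient `u`. [folklore] -/
private theorem twist_mulVec_perp (hH : ∀ i j, cmConjRingHom L (H i j) = H j i) (u : FiniteAdeleRing (𝓞 L) L)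
    {w : Fin n → L} (hw : hermForm (cmConjRingHom L) H w v = 0) :
    (1 + vecMulVec (u • adelicVecFin L v) r) *ᵥ adelicVecFin L w = adelicVecFin L w := by
  have hw' : hermForm (cmConjRingHom L) H v w = 0 := by
    rw [hermForm_conj_symm L H hH, hw, map_zero]
  rw [add_mulVec, one_mulVec, vecMulVec_mulVec, hr, hw', map_zero, MulOpposite.op_zero, zero_smul, add_zero]

include hr in
/-- `d(t) · d(t') = 1` for `t·t' = 1` (the coefficients `u = (t-1)/h₀`, `u' = (t'-1)/h₀` satisfy
`u + u' + u·u'·h₀ = 0`). [folklore] -/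
private theorem twist_mul_twist (hv : hermForm (cmConjRingHom L) H v v ≠ 0) {t t' : FiniteAdeleRing (𝓞 L) L}
    (ht : t * t' = 1) :
    (1 + vecMulVec (((t - 1) * algebraMap L (FiniteAdeleRing (𝓞 L) L) (hermForm (cmConjRingHom L) H v v)⁻¹) •
        adelicVecFin L v) r) *
      (1 + vecMulVec (((t' - 1) * algebraMap L (FiniteAdeleRing (𝓞 L) L) (hermForm (cmConjRingHom L) H v v)⁻¹) •
        adelicVecFin L v) r) = 1 := by
  have hinv := alg_inv_mul_fin L H v hv
  set hi := algebraMap L (FiniteAdeleRing (𝓞 L) L) (hermForm (cmConjRingHom L) H v v)⁻¹ with hhi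
  have key : (t - 1) * hi + (t' - 1) * hi +
      (t - 1) * hi * ((t' - 1) * hi) * algebraMap L (FiniteAdeleRing (𝓞 L) L) (hermForm (cmConjRingHom L) H v v) =
        0 := by
    linear_combination hi * ht + ((t - 1) * (t' - 1) * hi) * hinv
  have hexp : (1 + vecMulVec (((t - 1) * hi) • adelicVecFin L v) r) *
      (1 + vecMulVec (((t' - 1) * hi) • adelicVecFin L v) r) =
      1 + (vecMulVec (((t - 1) * hi) • adelicVecFin L v) r + vecMulVec (((t' - 1) * hi) • adelicVecFin L v) r +
        vecMulVec (((t - 1) * hi) • adelicVecFin L v) r * vecMulVec (((t' - 1) * hi) • adelicVecFin L v) r) := by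
    simp only [Matrix.mul_add, Matrix.add_mul, Matrix.one_mul, Matrix.mul_one]
    abel
  rw [hexp, vecMulVec_mul_vecMulVec, dotProduct_smul, hr, smul_eq_mul]
  conv_rhs => rw [← add_zero (1 : Matrix (Fin n) (Fin n) (FiniteAdeleRing (𝓞 L) L))]
  congr 1
  refine Matrix.ext fun i j => ?_
  simp only [Matrix.add_apply, vecMulVec_apply, Pi.smul_apply, smul_eq_mul, Matrix.zero_apply]
  linear_combination (adelicVecFin L v i * r j) * key

variable
  (hσr : ∀ j : Fin n, conjFiniteAdele (↥(maximalRealSubfield L)) L (IsCMField.complexConj L) (r j) =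
    (finiteAdelicForm L n H *ᵥ adelicVecFin L v) j)
  (hrJ : adelicVecFin L (cmConjRingHom L ∘ v) ᵥ* finiteAdelicForm L n H = r)

include hσr in
/-- The conjugate-transpose of the twist: `(σ d)ᵀ = 1 + (H v ⊗ 1) ⊗ (σ u · c v ⊗ 1)` with
`σ u = (σ t - 1)/h₀` (`h₀ = ⟪v, v⟫` is `c`-fixed). [folklore] -/
private theorem transpose_map_twist (hH : ∀ i j, cmConjRingHom L (H i j) = H j i) (t : FiniteAdeleRing (𝓞 L) L) :
    ((1 + vecMulVec (((t - 1) * algebraMap L (FiniteAdeleRing (𝓞 L) L) (hermForm (cmConjRingHom L) H v v)⁻¹) •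
        adelicVecFin L v) r).map (conjFiniteAdele (↥(maximalRealSubfield L)) L (IsCMField.complexConj L)))ᵀ =
      1 + vecMulVec (finiteAdelicForm L n H *ᵥ adelicVecFin L v)
        (((conjFiniteAdele (↥(maximalRealSubfield L)) L (IsCMField.complexConj L) t - 1) *
            algebraMap L (FiniteAdeleRing (𝓞 L) L) (hermForm (cmConjRingHom L) H v v)⁻¹) •
          adelicVecFin L (cmConjRingHom L ∘ v)) := by
  have hσu : conjFiniteAdele (↥(maximalRealSubfield L)) L (IsCMField.complexConj L)
      ((t - 1) * algebraMap L (FiniteAdeleRing (𝓞 L) L) (hermForm (cmConjRingHom L) H v v)⁻¹) =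
      (conjFiniteAdele (↥(maximalRealSubfield L)) L (IsCMField.complexConj L) t - 1) *
        algebraMap L (FiniteAdeleRing (𝓞 L) L) (hermForm (cmConjRingHom L) H v v)⁻¹ := by
    simp only [map_mul, map_sub, map_one, conjFiniteAdele_algebraMap_fin, map_inv₀, conj_hermForm_self_eq L H hH]
  have hσv : ∀ i, conjFiniteAdele (↥(maximalRealSubfield L)) L (IsCMField.complexConj L) (adelicVecFin L v i) =
      adelicVecFin L (cmConjRingHom L ∘ v) i := fun i => conjFiniteAdele_algebraMap_fin L (v i)
  rw [Matrix.map_add _ (map_add _), Matrix.map_one _ (map_zero _) (map_one _), transpose_add, transpose_one]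
  congr 1
  refine Matrix.ext fun i j => ?_
  simp only [transpose_apply, Matrix.map_apply, vecMulVec_apply, Pi.smul_apply, smul_eq_mul, map_mul, hσu, hσv,
    hσr]
  ring

include hr hσr hrJ in
/-- **Unitarity of the twist**: `(σ d)ᵀ · (H ⊗ 1) · d = H ⊗ 1` when `t · σ(t) = 1`. [folklore] -/
private theorem twist_mem (hH : ∀ i j, cmConjRingHom L (H i j) = H j i) (hv : hermForm (cmConjRingHom L) H v v ≠ 0)
    {t : FiniteAdeleRing (𝓞 L) L}
    (ht : t * conjFiniteAdele (↥(maximalRealSubfield L)) L (IsCMField.complexConj L) t = 1) :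
    ((1 + vecMulVec (((t - 1) * algebraMap L (FiniteAdeleRing (𝓞 L) L) (hermForm (cmConjRingHom L) H v v)⁻¹) •
        adelicVecFin L v) r).map (conjFiniteAdele (↥(maximalRealSubfield L)) L (IsCMField.complexConj L)))ᵀ *
        finiteAdelicForm L n H *
      (1 + vecMulVec (((t - 1) * algebraMap L (FiniteAdeleRing (𝓞 L) L) (hermForm (cmConjRingHom L) H v v)⁻¹) •
        adelicVecFin L v) r) = finiteAdelicForm L n H := by
  have hinv := alg_inv_mul_fin L H v hv
  rw [transpose_map_twist L H v r hσr hH t]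
  set t' := conjFiniteAdele (↥(maximalRealSubfield L)) L (IsCMField.complexConj L) t with ht'
  set hi := algebraMap L (FiniteAdeleRing (𝓞 L) L) (hermForm (cmConjRingHom L) H v v)⁻¹ with hhi
  set J := finiteAdelicForm L n H with hJ
  set av := adelicVecFin L v with hav
  set acv := adelicVecFin L (cmConjRingHom L ∘ v) with hacv
  have key : (t - 1) * hi + (t' - 1) * hi +
      (t - 1) * hi * ((t' - 1) * hi) * algebraMap L (FiniteAdeleRing (𝓞 L) L) (hermForm (cmConjRingHom L) H v v) =
        0 := by
    linear_combination hi * ht + ((t - 1) * (t' - 1) * hi) * hinv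
  have hrav : r ⬝ᵥ av = algebraMap L (FiniteAdeleRing (𝓞 L) L) (hermForm (cmConjRingHom L) H v v) := hr v
  -- expand `(1 + P) J (1 + Q)`
  have hexp : (1 + vecMulVec (J *ᵥ av) (((t' - 1) * hi) • acv)) * J * (1 + vecMulVec (((t - 1) * hi) • av) r) =
      J + (vecMulVec (J *ᵥ av) (((t' - 1) * hi) • acv) * J + J * vecMulVec (((t - 1) * hi) • av) r +
        vecMulVec (J *ᵥ av) (((t' - 1) * hi) • acv) * J * vecMulVec (((t - 1) * hi) • av) r) := by
    simp only [Matrix.mul_add, Matrix.add_mul, Matrix.one_mul, Matrix.mul_one]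
    abel
  rw [hexp, vecMulVec_mul, smul_vecMul, hrJ, mul_vecMulVec, mulVec_smul, vecMulVec_mul_vecMulVec, smul_dotProduct,
    dotProduct_smul, hrav]
  conv_rhs => rw [← add_zero J]
  congr 1
  refine Matrix.ext fun i j => ?_
  simp only [Matrix.add_apply, vecMulVec_apply, Pi.smul_apply, smul_eq_mul, Matrix.zero_apply]
  linear_combination ((J *ᵥ av) i * r j) * key

omit hr hσr hrJ

/-- **The diagonal twist exists in `U(H)(𝔸_{L⁺,f})`, at every rank**: for `H ∈ M_n(L)` `c`-hermitian, `v ∈ Lⁿ`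
with `⟪v, v⟫_H ≠ 0` and a finite idèle `t` with `t · c(t) = 1` there is `d ∈ U(H)(𝔸_{L⁺,f})` multiplying
`v ⊗ 1` by `t` and fixing `v^{⊥_H}` pointwise — the representative `z_r(τ) ∈ T(𝔸^f)` of
[Deligne1979ShimuraVarieties] 2.2.4 / `r_x(s) ∈ T(𝔸_f)` of [Milne2005ShimuraVarieties] (61) for the diagonal torus
at `v` (rank-generic twin of ★ `exists_isDiagTwist`, which is `n = 3`): `d = 1 + ((t-1)/⟪v,v⟫ • v⊗1) ⊗ ⟪v, ·⟫`,
with inverse the same at `c(t)`. [cite: Milne2005ShimuraVarieties, (61)–(62) p. 114]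
[cite: Deligne1979ShimuraVarieties, 2.2.4] -/
theorem exists_finAdelic_mulVec_eq_smul_and_perp (hH : ∀ i j, cmConjRingHom L (H i j) = H j i)
    (hv : hermForm (cmConjRingHom L) H v v ≠ 0) {t : FiniteAdeleRing (𝓞 L) L}
    (ht : t * conjFiniteAdele (↥(maximalRealSubfield L)) L (IsCMField.complexConj L) t = 1) :
    ∃ d : finAdelic (↥(maximalRealSubfield L)) L (IsCMField.complexConj L) n H,
      ((d : GL (Fin n) (FiniteAdeleRing (𝓞 L) L)) : Matrix (Fin n) (Fin n) (FiniteAdeleRing (𝓞 L) L)) *ᵥ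
          adelicVecFin L v = t • adelicVecFin L v ∧
        ∀ w : Fin n → L, hermForm (cmConjRingHom L) H w v = 0 →
          ((d : GL (Fin n) (FiniteAdeleRing (𝓞 L) L)) : Matrix (Fin n) (Fin n) (FiniteAdeleRing (𝓞 L) L)) *ᵥ
            adelicVecFin L w = adelicVecFin L w := by
  -- the covector `r = ⟪v, ·⟫ ⊗ 1` and its three bookkeeping identities
  set r : Fin n → FiniteAdeleRing (𝓞 L) L :=
    fun j => algebraMap L (FiniteAdeleRing (𝓞 L) L) (((cmConjRingHom L ∘ v) ᵥ* H) j) with hr_def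
  have hr : ∀ w : Fin n → L,
      r ⬝ᵥ adelicVecFin L w = algebraMap L (FiniteAdeleRing (𝓞 L) L) (hermForm (cmConjRingHom L) H v w) :=
    fun w => covec_dotProduct_adelicVecFin L H v w
  have hcc : ∀ x : L, cmConjRingHom L (cmConjRingHom L x) = x := fun x => by
    rw [cmConjRingHom_apply, cmConjRingHom_apply]
    exact IsCMField.complexConj_apply_apply L x
  have hσr : ∀ j : Fin n, conjFiniteAdele (↥(maximalRealSubfield L)) L (IsCMField.complexConj L) (r j) =
      (finiteAdelicForm L n H *ᵥ adelicVecFin L v) j := by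
    intro j
    rw [hr_def]
    dsimp only
    rw [conjFiniteAdele_algebraMap_fin]
    simp only [vecMul, dotProduct, Function.comp_apply, map_sum, map_mul, hcc, hH, finiteAdelicForm,
      mulVec, Matrix.map_apply, adelicVecFin]
    refine Finset.sum_congr rfl fun i _ => ?_
    ring
  have hrJ : adelicVecFin L (cmConjRingHom L ∘ v) ᵥ* finiteAdelicForm L n H = r := by
    funext j
    simp only [hr_def, vecMul, dotProduct, finiteAdelicForm, Matrix.map_apply, adelicVecFin, Function.comp_apply,
      map_sum, map_mul]
  -- `c(t)` is the inverse eigenvalue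
  have ht' : conjFiniteAdele (↥(maximalRealSubfield L)) L (IsCMField.complexConj L) t * t = 1 := by
    rw [mul_comm]; exact ht
  -- the element of `GL_n(𝔸_{L,f})`
  let g : GL (Fin n) (FiniteAdeleRing (𝓞 L) L) :=
    ⟨1 + vecMulVec (((t - 1) * algebraMap L (FiniteAdeleRing (𝓞 L) L) (hermForm (cmConjRingHom L) H v v)⁻¹) •
        adelicVecFin L v) r,
      1 + vecMulVec (((conjFiniteAdele (↥(maximalRealSubfield L)) L (IsCMField.complexConj L) t - 1) *
          algebraMap L (FiniteAdeleRing (𝓞 L) L) (hermForm (cmConjRingHom L) H v v)⁻¹) • adelicVecFin L v) r,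
      twist_mul_twist L H v r hr hv ht, twist_mul_twist L H v r hr hv ht'⟩
  refine ⟨⟨g, ?_⟩, ?_, ?_⟩
  · rw [mem_finAdelic_iff]
    exact twist_mem L H v r hr hσr hrJ hH hv ht
  · exact twist_mulVec_self L H v r hr hv t
  · intro w hw
    exact twist_mulVec_perp L H v r hr hH _ hw

/-- **The reciprocity twist exists at every rank** for every finite idèle `s`: eigenvalue
`recipFactor s = c(s)·s⁻¹` on `v` (unitary by ★ `recipFactor_mul_conj`), identity on `v^{⊥_H}`.
[cite: Milne2005ShimuraVarieties, (61)–(62) p. 114] [cite: Deligne1979ShimuraVarieties, 2.2.4] -/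
theorem exists_finAdelic_mulVec_eq_recipFactor_smul_and_perp (hH : ∀ i j, cmConjRingHom L (H i j) = H j i)
    (hv : hermForm (cmConjRingHom L) H v v ≠ 0) (s : (FiniteAdeleRing (𝓞 L) L)ˣ) :
    ∃ d : finAdelic (↥(maximalRealSubfield L)) L (IsCMField.complexConj L) n H,
      ((d : GL (Fin n) (FiniteAdeleRing (𝓞 L) L)) : Matrix (Fin n) (Fin n) (FiniteAdeleRing (𝓞 L) L)) *ᵥ
          adelicVecFin L v = recipFactor L s • adelicVecFin L v ∧
        ∀ w : Fin n → L, hermForm (cmConjRingHom L) H w v = 0 →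
          ((d : GL (Fin n) (FiniteAdeleRing (𝓞 L) L)) : Matrix (Fin n) (Fin n) (FiniteAdeleRing (𝓞 L) L)) *ᵥ
            adelicVecFin L w = adelicVecFin L w :=
  exists_finAdelic_mulVec_eq_smul_and_perp L H v hH hv (recipFactor_mul_conj s)

end Twist

/-! ### §3. The curve datum: the twist of `RecordGS.recip` / `RecordSystemGS.recip` exists -/

section Curve

variable (Jstar : Matrix (Fin 2) (Fin 2) L)

/-- **The diagonal twist of a CM pair of the unitary Shimura CURVE exists**: for `J⋆ ∈ M₂(L)` `c`-hermitian,
`w ∈ L²` anisotropic and `t` with `t · c(t) = 1`, some `d ∈ U(J⋆)(𝔸_{L⁺,f})` has `IsDiagTwistGS L J⋆ w t d` (★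
`UnitaryShimuraCurveRecord`: `t` on `w`, `1` on `w^⊥`). [cite: Milne2005ShimuraVarieties, (61)–(62) p. 114]
[cite: Deligne1979ShimuraVarieties, 2.2.4] -/
theorem exists_isDiagTwistGS (hJ : ∀ i j, cmConjRingHom L (Jstar i j) = Jstar j i) {w : Fin 2 → L}
    (hw : hermForm (cmConjRingHom L) Jstar w w ≠ 0) {t : FiniteAdeleRing (𝓞 L) L}
    (ht : t * conjFiniteAdele (↥(maximalRealSubfield L)) L (IsCMField.complexConj L) t = 1) :
    ∃ d : finAdelic (↥(maximalRealSubfield L)) L (IsCMField.complexConj L) 2 Jstar, IsDiagTwistGS L Jstar w t d :=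
  exists_finAdelic_mulVec_eq_smul_and_perp L Jstar w hJ hw ht

/-- **The reciprocity twist `d = r_x(s)` of the curve datum exists** for every finite idèle `s` — the
`∀ d, IsDiagTwistGS … (recipFactor L s) d → …` quantifier of ★ `RecordGS.recip` / `RecordSystemGS.recip` is never
vacuous (rank-2 twin of ★ `exists_isDiagTwist_recipFactor`). [cite: Milne2005ShimuraVarieties, (61)–(62) p. 114]
[cite: Deligne1979ShimuraVarieties, 2.2.4] -/
theorem exists_isDiagTwistGS_recipFactor (hJ : ∀ i j, cmConjRingHom L (Jstar i j) = Jstar j i)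
    {w : Fin 2 → L} (hw : hermForm (cmConjRingHom L) Jstar w w ≠ 0) (s : (FiniteAdeleRing (𝓞 L) L)ˣ) :
    ∃ d : finAdelic (↥(maximalRealSubfield L)) L (IsCMField.complexConj L) 2 Jstar,
      IsDiagTwistGS L Jstar w (recipFactor L s) d :=
  exists_isDiagTwistGS L Jstar hJ hw (recipFactor_mul_conj s)

/-- The same from the TRANSPOSE spelling `ᵗ(J⋆^c) = J⋆` of hermitian-ness (the hypothesis form of ★
`ShimuraSetGS.eq_of_forall_mk_eq`). [cite: Milne2005ShimuraVarieties, (61)–(62) p. 114] -/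
theorem exists_isDiagTwistGS_recipFactor' (hJ : (Jstar.map (IsCMField.complexConj L))ᵀ = Jstar)
    {w : Fin 2 → L} (hw : hermForm (cmConjRingHom L) Jstar w w ≠ 0) (s : (FiniteAdeleRing (𝓞 L) L)ˣ) :
    ∃ d : finAdelic (↥(maximalRealSubfield L)) L (IsCMField.complexConj L) 2 Jstar,
      IsDiagTwistGS L Jstar w (recipFactor L s) d :=
  exists_isDiagTwistGS_recipFactor L Jstar (conj_apply_eq_of_transpose_map_eq L Jstar hJ) hw s

end Curve

end Literature.AlgebraicGeometry.ShimuraVarieties.UnitaryCanonicalModel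

end
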